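import Summits.Langlands.Langlands.Theses.SeedReachSplit
import Summits.Langlands.Langlands.Theorems.SeedReachSymmetricPowerKernel

/-!
# SeedReachSplit — BRIDGE of the lens-3 g15 node (REV 1) onto the BORN route decls

Route `route-Langlands-SeedReachSplit` rev 1 (@fc3bd7e7fc24; lens-3-g15 DELTA node L1120, crit-1 CLEARED row 228, writer-1 ROUTE-EDIT L1137):
items C `SeedIsolatedSymPower` stmt-Langlands-26838 · B `ThetaSeededSymPower` 26839 · A `BaseChangeSeededSymPower` 26840 · FRAME″ `SeedReachFrame`
26675 · Assembly 26676 (closed).  Rev 1 = rev 0 + a class-wide LEVEL SET `S` in the admissible-congruence edge (both forms unramified outside `S`,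
every place above `p` outside `S`), three insertions per dial occurrence and nothing else.

The rev-0 twin is landed as `Theorems/SeedReachSymmetricPower.lean` (PART A, p792234) + `Theorems/SeedReachSymmetricPowerKernel.lean` (PART B,
p792846) in namespace `…Theorems.SeedReach`; its EQUIV node SPF `SymPowerFunctoriality`, the antecedent AVX `SymPowerAvatarExists`, the
vocabulary (`IsBaseChangeForm`, `IsThetaForm`, `SymSatakeCompatibleAt`, `IsSymWeaklyAutomorphic`) and the EQUIV kernels `fc_of_spf` / `spf_of_fc` /
`fc_iff_spf` / `cm_of_langlands` are UNCHANGED by rev 1 and are imported, not restated (Theorems files are append-only; a replacement of PART A is not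
possible).  This file (namespace `…Theorems.SeedReachRev1`) adds exactly the rev-1 content and certifies the kernels ON THE LEDGER DECLS:

* §1 the rev-1 edge `AdmissibleSymCongruence K₀ n hcpt₂ S π π′` and dials `BCReachable` / `ThetaReachable` (∃ S), with the `Iff.rfl` bridges
  `bcReachable_iff` / `thetaReachable_iff` to the texts inlined in the route items, and `a_iff` / `b_iff` / `c_iff` / `frame_iff` stating that the
  ROUTE decls `Theses.SeedReachSplit.{BaseChangeSeededSymPower, ThetaSeededSymPower, SeedIsolatedSymPower, SeedReachFrame}` ARE «SPF restricted to
  the dial» (kernel-checked text identity);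
* §2 the kernels on the route decls: `a_of_spf`, `b_of_spf`, `c_of_spf` (WEAKER), `spf_of_pieces` / `spf_iff_pieces` (EXACT: SPF ⟺ A ∧ B ∧ C, two
  excluded middles), `fc_iff_pieces (hAV)`, `fc_of_pieces` (outright), `a/b/c_of_fc (hAV)`, `frame_of_host`, `closes` (= the route's own
  `Theses.SeedReachSplit.closes`, re-proved from the pieces), `langlands_of_pieces`, necessity `spf/a/b/c/frame_of_langlands`, `langlands_iff_items (hAV)`.

Nothing here proves `Langlands`; the items A (print, ATTACKED), B (open: RedALT), C (declared residual REACH) are open.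
-/

set_option linter.unusedVariables false
set_option linter.unusedSectionVars false
set_option linter.dupNamespace false -- project-wide option; `Summit.Langlands.Langlands` is the mandated namespace

namespace Summit.Langlands.Langlands.Theorems.SeedReachRev1

open Polynomial
open Summit.Langlands.Langlands.Theses.SymmetricPowerAnchorSplit (AnchorlessSymTypeAutomorphy CMSymmetricPowerAutomorphy
  LowSymmetricPowerAutomorphy HilbertSymmetricPowerAutomorphy CliffordSolvableDescent SolvableAnchorTransport AvatarSymmetricPowerFrame)
open Summit.Langlands.Langlands.Theorems.MonodromyDichotomySymmetricPowerAnchor (IsPinnedGeometric IsLieIrreducible RankIH IsSymShadow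
  HasCohomologicalPartner IsWeaklyAutomorphic cm_of_langlands)

open Summit.Langlands.Langlands.Theorems.SeedReach (SymSatakeCompatibleAt IsSymWeaklyAutomorphic IsBaseChangeForm IsThetaForm
  SymPowerFunctoriality SymPowerAvatarExists fc_of_spf spf_of_fc fc_iff_spf)

/-! ## §1 The rev-1 edge and dials (level set `S`), and the `Iff.rfl` bridges to the ROUTE decls -/

/-- EDGE of the seed graph: an ADMISSIBLE `Sym^(n-1)`-CONGRUENCE between cuspidal `π, π'` on `GL₂/K₀` — at a prime `p > n²`
unramified in `K₀`, above which both forms are unramified, both of the same regular L-algebraic infinity type `T` with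
Fontaine–Laffaille-small `Sym^(n-1)`-weight (`(n-1)(d_e + d_ē) + 2 < p`), with `p`-adic avatars `s, s'` whose `Sym^(n-1)`-shadows
`R, R'` have a COMMON residual representation `τ` carrying the ACC+ package (abs. irreducible, decomposed generic, abs. irreducible
and enormous on `Γ_(K₀(ζ_p))`, a scalar outside it) — exactly hypotheses (2)–(5) of ACC+ Thm 6.1.1 for `ρ = Sym^(n-1) r_(π,p)`
seeded by `Sym^(n-1) π'` (vocabulary of the tree fact `…ACCGHLNSTT2023.automorphyLifting_crystalline_weightZero`).
LEVEL SET `S` (rev 1): both forms are unramified outside the class-wide finite set `S` and every place above `p` lies outside `S` —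
so that along a CHAIN the 6.1.1-witness `Sym^(n-1) π'` is unramified above `p` (Thm 6.1.1 needs `π_v` unramified at `v ∣ p` and
outputs `Π_v` unramified only at `v ∣ p` or where both `ρ` and the witness are unramified, arXiv:1812.09999 p.64; the converse
local–global direction is not in print, cf. `Literature.Barriers.Langlands.MonodromyNotClosedUnderPadicLimits`). -/
def AdmissibleSymCongruence (K₀ : Type) [Field K₀] [NumberField K₀] (n : ℕ) (hcpt₂ : Literature.NumberTheory.Automorphic.isCompact_glFiniteIntegralLevel 2 K₀)
    (S : Finset (IsDedekindDomain.HeightOneSpectrum (NumberField.RingOfIntegers K₀))) (π π' : Literature.NumberTheory.Automorphic.CuspidalAutomorphicRepData 2 K₀ hcpt₂) : Prop :=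
  (∀ v : IsDedekindDomain.HeightOneSpectrum (NumberField.RingOfIntegers K₀), v ∉ S → π.1.IsUnramifiedAt v ∧ π'.1.IsUnramifiedAt v) ∧ ∃ (p : ℕ) (_ : Fact p.Prime) (ι' : PadicAlgCl p ≃+* ℂ) (T : Literature.NumberTheory.Automorphic.InfinityType K₀ 2) (s s' : Literature.NumberTheory.GaloisRepresentations.FramedGaloisRep K₀ (PadicAlgCl p) 2) (R R' : Literature.NumberTheory.GaloisRepresentations.FramedGaloisRep K₀ (PadicAlgCl p) n) (τ : Field.absoluteGaloisGroup K₀ →* Matrix.GeneralLinearGroup (Fin n) (Literature.NumberTheory.GaloisRepresentations.padicAlgClResidueField p)), n ^ 2 < p ∧ Algebra.IsUnramifiedIn (NumberField.RingOfIntegers K₀) (Ideal.span {(p : ℤ)}) ∧ (∀ v : IsDedekindDomain.HeightOneSpectrum (NumberField.RingOfIntegers K₀), ((p : ℕ) : NumberField.RingOfIntegers K₀) ∈ v.asIdeal → v ∉ S) ∧ (∀ v : IsDedekindDomain.HeightOneSpectrum (NumberField.RingOfIntegers K₀), ((p : ℕ) : NumberField.RingOfIntegers K₀) ∈ v.asIdeal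 → π.1.IsUnramifiedAt v ∧ π'.1.IsUnramifiedAt v) ∧ π.1.HasInfinityType T ∧ π'.1.HasInfinityType T ∧ T.IsLAlgebraic ∧ T.IsRegular ∧ (∀ e : K₀ →+* ℂ, ∀ w₁ ∈ T e, ∀ w₂ ∈ T e, ((n : ℝ) - 1) * (‖w₁.a - w₂.a‖ + ‖w₁.b - w₂.b‖ + 2) + 2 * n < (p : ℝ)) ∧ (∀ᶠ v : IsDedekindDomain.HeightOneSpectrum (NumberField.RingOfIntegers K₀) in Filter.cofinite, SatakeFrobCompatibleAt ι' π.1 s v) ∧ (∀ᶠ v : IsDedekindDomain.HeightOneSpectrum (NumberField.RingOfIntegers K₀) in Filter.cofinite, SatakeFrobCompatibleAt ι' π'.1 s' v) ∧ Summit.Langlands.Langlands.Theorems.MonodromyDichotomySymmetricPowerAnchor.IsSymShadow K₀ p n R s ∧ Summit.Langlands.Langlands.Theorems.MonodromyDichotomySymmetricPowerAnchor.IsSymShadow K₀ p n R' s' ∧ R.IsResidualRepOf (RingHom.id _) τ ∧ R'.IsResidualRepOf (RingHom.id _) τ ∧ Literature.NumberTheory.GaloisRepresentations.IsAbsIrreducible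 τ ∧ Literature.NumberTheory.GaloisRepresentations.IsDecomposedGeneric τ ∧ Literature.NumberTheory.GaloisRepresentations.IsAbsIrreducible (τ.comp (Literature.NumberTheory.GaloisRepresentations.absGaloisGroupAdjoinRootsOfUnity K₀ p).subtype) ∧ Literature.NumberTheory.GaloisRepresentations.Subgroup.IsEnormous ((Literature.NumberTheory.GaloisRepresentations.absGaloisGroupAdjoinRootsOfUnity K₀ p).map τ) ∧ ∃ g₀ : Field.absoluteGaloisGroup K₀, g₀ ∉ Literature.NumberTheory.GaloisRepresentations.absGaloisGroupAdjoinRootsOfUnity K₀ p ∧ ∃ c : Literature.NumberTheory.GaloisRepresentations.padicAlgClResidueField p, ((τ g₀ : Matrix.GeneralLinearGroup (Fin n) (Literature.NumberTheory.GaloisRepresentations.padicAlgClResidueField p)) : Matrix (Fin n) (Fin n) (Literature.NumberTheory.GaloisRepresentations.padicAlgClResidueField p)) = c • (1 : Matrix (Fin n) (Fin n) (Literature.NumberTheory.GaloisRepresentations.padicAlgClResidueField p))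

/-- DIAL A — `σ₀` is BASE-CHANGE-REACHABLE: its cohomological partner `π₀` is joined to a base-change form by a finite chain of
admissible `Sym^(n-1)`-congruences (`Relation.ReflTransGen`) at a common level set `S`. -/
def BCReachable (K₀ : Type) [Field K₀] [NumberField K₀] (n : ℕ) (ℓ : ℕ) [Fact ℓ.Prime] (ι : PadicAlgCl ℓ ≃+* ℂ)
    (σ₀ : Literature.NumberTheory.GaloisRepresentations.FramedGaloisRep K₀ (PadicAlgCl ℓ) 2) : Prop :=
  ∃ (hcpt₂ : Literature.NumberTheory.Automorphic.isCompact_glFiniteIntegralLevel 2 K₀) (S : Finset (IsDedekindDomain.HeightOneSpectrum (NumberField.RingOfIntegers K₀))) (π₀ β : Literature.NumberTheory.Automorphic.CuspidalAutomorphicRepData 2 K₀ hcpt₂), (∀ᶠ v : IsDedekindDomain.HeightOneSpectrum (NumberField.RingOfIntegers K₀) in Filter.cofinite, SatakeFrobCompatibleAt ι π₀.1 σ₀ v) ∧ Relation.ReflTransGen (fun π π' : Literature.NumberTheory.Automorphic.CuspidalAutomorphicRepData 2 K₀ hcpt₂ => (∀ v : IsDedekindDomain.HeightOneSpectrum (NumberField.RingOfIntegers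 K₀), v ∉ S → π.1.IsUnramifiedAt v ∧ π'.1.IsUnramifiedAt v) ∧ ∃ (p : ℕ) (_ : Fact p.Prime) (ι' : PadicAlgCl p ≃+* ℂ) (T : Literature.NumberTheory.Automorphic.InfinityType K₀ 2) (s s' : Literature.NumberTheory.GaloisRepresentations.FramedGaloisRep K₀ (PadicAlgCl p) 2) (R R' : Literature.NumberTheory.GaloisRepresentations.FramedGaloisRep K₀ (PadicAlgCl p) n) (τ : Field.absoluteGaloisGroup K₀ →* Matrix.GeneralLinearGroup (Fin n) (Literature.NumberTheory.GaloisRepresentations.padicAlgClResidueField p)), n ^ 2 < p ∧ Algebra.IsUnramifiedIn (NumberField.RingOfIntegers K₀) (Ideal.span {(p : ℤ)}) ∧ (∀ v : IsDedekindDomain.HeightOneSpectrum (NumberField.RingOfIntegers K₀), ((p : ℕ) : NumberField.RingOfIntegers K₀) ∈ v.asIdeal → v ∉ S) ∧ (∀ v : IsDedekindDomain.HeightOneSpectrum (NumberField.RingOfIntegers K₀), ((p : ℕ) : NumberField.RingOfIntegers K₀) ∈ v.asIdeal → π.1.IsUnramifiedAt v ∧ π'.1.IsUnramifiedAt v) ∧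 π.1.HasInfinityType T ∧ π'.1.HasInfinityType T ∧ T.IsLAlgebraic ∧ T.IsRegular ∧ (∀ e : K₀ →+* ℂ, ∀ w₁ ∈ T e, ∀ w₂ ∈ T e, ((n : ℝ) - 1) * (‖w₁.a - w₂.a‖ + ‖w₁.b - w₂.b‖ + 2) + 2 * n < (p : ℝ)) ∧ (∀ᶠ v : IsDedekindDomain.HeightOneSpectrum (NumberField.RingOfIntegers K₀) in Filter.cofinite, SatakeFrobCompatibleAt ι' π.1 s v) ∧ (∀ᶠ v : IsDedekindDomain.HeightOneSpectrum (NumberField.RingOfIntegers K₀) in Filter.cofinite, SatakeFrobCompatibleAt ι' π'.1 s' v) ∧ Summit.Langlands.Langlands.Theorems.MonodromyDichotomySymmetricPowerAnchor.IsSymShadow K₀ p n R s ∧ Summit.Langlands.Langlands.Theorems.MonodromyDichotomySymmetricPowerAnchor.IsSymShadow K₀ p n R' s' ∧ R.IsResidualRepOf (RingHom.id _) τ ∧ R'.IsResidualRepOf (RingHom.id _) τ ∧ Literature.NumberTheory.GaloisRepresentations.IsAbsIrreducible τ ∧ Literature.NumberTheory.GaloisRepresentations.IsDecomposedGeneric τ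 ∧ Literature.NumberTheory.GaloisRepresentations.IsAbsIrreducible (τ.comp (Literature.NumberTheory.GaloisRepresentations.absGaloisGroupAdjoinRootsOfUnity K₀ p).subtype) ∧ Literature.NumberTheory.GaloisRepresentations.Subgroup.IsEnormous ((Literature.NumberTheory.GaloisRepresentations.absGaloisGroupAdjoinRootsOfUnity K₀ p).map τ) ∧ ∃ g₀ : Field.absoluteGaloisGroup K₀, g₀ ∉ Literature.NumberTheory.GaloisRepresentations.absGaloisGroupAdjoinRootsOfUnity K₀ p ∧ ∃ c : Literature.NumberTheory.GaloisRepresentations.padicAlgClResidueField p, ((τ g₀ : Matrix.GeneralLinearGroup (Fin n) (Literature.NumberTheory.GaloisRepresentations.padicAlgClResidueField p)) : Matrix (Fin n) (Fin n) (Literature.NumberTheory.GaloisRepresentations.padicAlgClResidueField p)) = c • (1 : Matrix (Fin n) (Fin n) (Literature.NumberTheory.GaloisRepresentations.padicAlgClResidueField p))) π₀ β ∧ ∃ (p : ℕ) (_ : Fact p.Prime) (ι' : PadicAlgCl p ≃+* ℂ) (s : Literature.NumberTheory.GaloisRepresentations.FramedGaloisRep K₀ (PadicAlgCl p) 2), (∀ᶠ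 v : IsDedekindDomain.HeightOneSpectrum (NumberField.RingOfIntegers K₀) in Filter.cofinite, SatakeFrobCompatibleAt ι' β.1 s v) ∧ ∃ (F : Type) (_ : Field F) (_ : NumberField F) (_ : Algebra F K₀), NumberField.IsTotallyReal F ∧ Module.finrank F K₀ = 2 ∧ ∃ (sF : Literature.NumberTheory.GaloisRepresentations.FramedGaloisRep F (PadicAlgCl p) 2) (χ : Field.absoluteGaloisGroup K₀ →* PadicAlgCl p), sF.toGaloisRep.IsIrreducible ∧ Summit.Langlands.Langlands.Theorems.MonodromyDichotomySymmetricPowerAnchor.IsPinnedGeometric F p sF ∧ ∀ g : Field.absoluteGaloisGroup K₀, Literature.NumberTheory.GaloisRepresentations.FramedRep.charpoly s g = (Literature.NumberTheory.GaloisRepresentations.FramedRep.charpoly (sF.restrictField K₀) g).scaleRoots (χ g)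

/-- DIAL B — `σ₀` is THETA-REACHABLE: its partner is joined to an Eisenstein/theta form by a finite chain of admissible congruences at a common level set `S`. -/
def ThetaReachable (K₀ : Type) [Field K₀] [NumberField K₀] (n : ℕ) (ℓ : ℕ) [Fact ℓ.Prime] (ι : PadicAlgCl ℓ ≃+* ℂ)
    (σ₀ : Literature.NumberTheory.GaloisRepresentations.FramedGaloisRep K₀ (PadicAlgCl ℓ) 2) : Prop :=
  ∃ (hcpt₂ : Literature.NumberTheory.Automorphic.isCompact_glFiniteIntegralLevel 2 K₀) (S : Finset (IsDedekindDomain.HeightOneSpectrum (NumberField.RingOfIntegers K₀))) (π₀ β : Literature.NumberTheory.Automorphic.CuspidalAutomorphicRepData 2 K₀ hcpt₂), (∀ᶠ v : IsDedekindDomain.HeightOneSpectrum (NumberField.RingOfIntegers K₀) in Filter.cofinite, SatakeFrobCompatibleAt ι π₀.1 σ₀ v) ∧ Relation.ReflTransGen (fun π π' : Literature.NumberTheory.Automorphic.CuspidalAutomorphicRepData 2 K₀ hcpt₂ => (∀ v : IsDedekindDomain.HeightOneSpectrum (NumberField.RingOfIntegers K₀), v ∉ S → π.1.IsUnramifiedAt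 v ∧ π'.1.IsUnramifiedAt v) ∧ ∃ (p : ℕ) (_ : Fact p.Prime) (ι' : PadicAlgCl p ≃+* ℂ) (T : Literature.NumberTheory.Automorphic.InfinityType K₀ 2) (s s' : Literature.NumberTheory.GaloisRepresentations.FramedGaloisRep K₀ (PadicAlgCl p) 2) (R R' : Literature.NumberTheory.GaloisRepresentations.FramedGaloisRep K₀ (PadicAlgCl p) n) (τ : Field.absoluteGaloisGroup K₀ →* Matrix.GeneralLinearGroup (Fin n) (Literature.NumberTheory.GaloisRepresentations.padicAlgClResidueField p)), n ^ 2 < p ∧ Algebra.IsUnramifiedIn (NumberField.RingOfIntegers K₀) (Ideal.span {(p : ℤ)}) ∧ (∀ v : IsDedekindDomain.HeightOneSpectrum (NumberField.RingOfIntegers K₀), ((p : ℕ) : NumberField.RingOfIntegers K₀) ∈ v.asIdeal → v ∉ S) ∧ (∀ v : IsDedekindDomain.HeightOneSpectrum (NumberField.RingOfIntegers K₀), ((p : ℕ) : NumberField.RingOfIntegers K₀) ∈ v.asIdeal → π.1.IsUnramifiedAt v ∧ π'.1.IsUnramifiedAt v) ∧ π.1.HasInfinityType T ∧ π'.1.HasInfinityType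 T ∧ T.IsLAlgebraic ∧ T.IsRegular ∧ (∀ e : K₀ →+* ℂ, ∀ w₁ ∈ T e, ∀ w₂ ∈ T e, ((n : ℝ) - 1) * (‖w₁.a - w₂.a‖ + ‖w₁.b - w₂.b‖ + 2) + 2 * n < (p : ℝ)) ∧ (∀ᶠ v : IsDedekindDomain.HeightOneSpectrum (NumberField.RingOfIntegers K₀) in Filter.cofinite, SatakeFrobCompatibleAt ι' π.1 s v) ∧ (∀ᶠ v : IsDedekindDomain.HeightOneSpectrum (NumberField.RingOfIntegers K₀) in Filter.cofinite, SatakeFrobCompatibleAt ι' π'.1 s' v) ∧ Summit.Langlands.Langlands.Theorems.MonodromyDichotomySymmetricPowerAnchor.IsSymShadow K₀ p n R s ∧ Summit.Langlands.Langlands.Theorems.MonodromyDichotomySymmetricPowerAnchor.IsSymShadow K₀ p n R' s' ∧ R.IsResidualRepOf (RingHom.id _) τ ∧ R'.IsResidualRepOf (RingHom.id _) τ ∧ Literature.NumberTheory.GaloisRepresentations.IsAbsIrreducible τ ∧ Literature.NumberTheory.GaloisRepresentations.IsDecomposedGeneric τ ∧ Literature.NumberTheory.GaloisRepresentations.IsAbsIrreducible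 (τ.comp (Literature.NumberTheory.GaloisRepresentations.absGaloisGroupAdjoinRootsOfUnity K₀ p).subtype) ∧ Literature.NumberTheory.GaloisRepresentations.Subgroup.IsEnormous ((Literature.NumberTheory.GaloisRepresentations.absGaloisGroupAdjoinRootsOfUnity K₀ p).map τ) ∧ ∃ g₀ : Field.absoluteGaloisGroup K₀, g₀ ∉ Literature.NumberTheory.GaloisRepresentations.absGaloisGroupAdjoinRootsOfUnity K₀ p ∧ ∃ c : Literature.NumberTheory.GaloisRepresentations.padicAlgClResidueField p, ((τ g₀ : Matrix.GeneralLinearGroup (Fin n) (Literature.NumberTheory.GaloisRepresentations.padicAlgClResidueField p)) : Matrix (Fin n) (Fin n) (Literature.NumberTheory.GaloisRepresentations.padicAlgClResidueField p)) = c • (1 : Matrix (Fin n) (Fin n) (Literature.NumberTheory.GaloisRepresentations.padicAlgClResidueField p))) π₀ β ∧ ∃ (p : ℕ) (_ : Fact p.Prime) (ι' : PadicAlgCl p ≃+* ℂ) (s : Literature.NumberTheory.GaloisRepresentations.FramedGaloisRep K₀ (PadicAlgCl p) 2) (τ₂ : Field.absoluteGaloisGroup K₀ →* Matrix.GeneralLinearGroup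 (Fin 2) (Literature.NumberTheory.GaloisRepresentations.padicAlgClResidueField p)) (M : Type) (_ : Field M) (_ : NumberField M) (_ : Algebra K₀ M), n ^ 2 < p ∧ (∀ᶠ v : IsDedekindDomain.HeightOneSpectrum (NumberField.RingOfIntegers K₀) in Filter.cofinite, SatakeFrobCompatibleAt ι' β.1 s v) ∧ s.IsResidualRepOf (RingHom.id _) τ₂ ∧ 0 < Module.finrank K₀ M ∧ Module.finrank K₀ M ≤ 2 ∧ NumberField.IsCMField M ∧ ¬ Literature.NumberTheory.GaloisRepresentations.IsAbsIrreducible (τ₂.comp (Literature.NumberTheory.GaloisRepresentations.absGaloisRestrictMonoidHom K₀ M))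

/-- A is literally CTX → `BCReachable` → `IsSymWeaklyAutomorphic`. -/
theorem a_iff : Theses.SeedReachSplit.BaseChangeSeededSymPower ↔
    ∀ (K₀ : Type) [Field K₀] [NumberField K₀] (n : ℕ) (hcpt : Literature.NumberTheory.Automorphic.isCompact_glFiniteIntegralLevel n K₀), 6 ≤ n → Summit.Langlands.Langlands.Theorems.MonodromyDichotomySymmetricPowerAnchor.RankIH n → NumberField.IsCMField K₀ → ∀ (ℓ : ℕ) [Fact ℓ.Prime] (ι : PadicAlgCl ℓ ≃+* ℂ) (σ₀ : Literature.NumberTheory.GaloisRepresentations.FramedGaloisRep K₀ (PadicAlgCl ℓ) 2), σ₀.toGaloisRep.IsIrreducible → Summit.Langlands.Langlands.Theorems.MonodromyDichotomySymmetricPowerAnchor.IsPinnedGeometric K₀ ℓ σ₀ → Summit.Langlands.Langlands.Theorems.MonodromyDichotomySymmetricPowerAnchor.IsLieIrreducible K₀ ℓ σ₀ → Summit.Langlands.Langlands.Theorems.MonodromyDichotomySymmetricPowerAnchor.HasCohomologicalPartner K₀ ℓ ι σ₀ → BCReachable K₀ n ℓ ι σ₀ → IsSymWeaklyAutomorphic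 K₀ n hcpt ℓ ι σ₀ := Iff.rfl

/-- B is literally CTX → ¬`BCReachable` → `ThetaReachable` → `IsSymWeaklyAutomorphic`. -/
theorem b_iff : Theses.SeedReachSplit.ThetaSeededSymPower ↔
    ∀ (K₀ : Type) [Field K₀] [NumberField K₀] (n : ℕ) (hcpt : Literature.NumberTheory.Automorphic.isCompact_glFiniteIntegralLevel n K₀), 6 ≤ n → Summit.Langlands.Langlands.Theorems.MonodromyDichotomySymmetricPowerAnchor.RankIH n → NumberField.IsCMField K₀ → ∀ (ℓ : ℕ) [Fact ℓ.Prime] (ι : PadicAlgCl ℓ ≃+* ℂ) (σ₀ : Literature.NumberTheory.GaloisRepresentations.FramedGaloisRep K₀ (PadicAlgCl ℓ) 2), σ₀.toGaloisRep.IsIrreducible → Summit.Langlands.Langlands.Theorems.MonodromyDichotomySymmetricPowerAnchor.IsPinnedGeometric K₀ ℓ σ₀ → Summit.Langlands.Langlands.Theorems.MonodromyDichotomySymmetricPowerAnchor.IsLieIrreducible K₀ ℓ σ₀ → Summit.Langlands.Langlands.Theorems.MonodromyDichotomySymmetricPowerAnchor.HasCohomologicalPartner K₀ ℓ ι σ₀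 → ¬ BCReachable K₀ n ℓ ι σ₀ → ThetaReachable K₀ n ℓ ι σ₀ → IsSymWeaklyAutomorphic K₀ n hcpt ℓ ι σ₀ := Iff.rfl

/-- C is literally CTX → ¬`BCReachable` → ¬`ThetaReachable` → `IsSymWeaklyAutomorphic`. -/
theorem c_iff : Theses.SeedReachSplit.SeedIsolatedSymPower ↔
    ∀ (K₀ : Type) [Field K₀] [NumberField K₀] (n : ℕ) (hcpt : Literature.NumberTheory.Automorphic.isCompact_glFiniteIntegralLevel n K₀), 6 ≤ n → Summit.Langlands.Langlands.Theorems.MonodromyDichotomySymmetricPowerAnchor.RankIH n → NumberField.IsCMField K₀ → ∀ (ℓ : ℕ) [Fact ℓ.Prime] (ι : PadicAlgCl ℓ ≃+* ℂ) (σ₀ : Literature.NumberTheory.GaloisRepresentations.FramedGaloisRep K₀ (PadicAlgCl ℓ) 2), σ₀.toGaloisRep.IsIrreducible → Summit.Langlands.Langlands.Theorems.MonodromyDichotomySymmetricPowerAnchor.IsPinnedGeometric K₀ ℓ σ₀ → Summit.Langlands.Langlands.Theorems.MonodromyDichotomySymmetricPowerAnchor.IsLieIrreducible K₀ ℓ σ₀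 → Summit.Langlands.Langlands.Theorems.MonodromyDichotomySymmetricPowerAnchor.HasCohomologicalPartner K₀ ℓ ι σ₀ → ¬ BCReachable K₀ n ℓ ι σ₀ → ¬ ThetaReachable K₀ n ℓ ι σ₀ → IsSymWeaklyAutomorphic K₀ n hcpt ℓ ι σ₀ := Iff.rfl

/-- FRAME″ is literally SPF → Langlands. -/
theorem frame_iff : Theses.SeedReachSplit.SeedReachFrame ↔ (SymPowerFunctoriality → _root_.Langlands) := Iff.rfl

/-- `BCReachable` unfolds to: a compatible cuspidal π₀ on GL₂ joined by an admissible chain to a base-change form. -/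
theorem bcReachable_iff (K₀ : Type) [Field K₀] [NumberField K₀] (n ℓ : ℕ) [Fact ℓ.Prime] (ι : PadicAlgCl ℓ ≃+* ℂ)
    (σ₀ : Literature.NumberTheory.GaloisRepresentations.FramedGaloisRep K₀ (PadicAlgCl ℓ) 2) :
    BCReachable K₀ n ℓ ι σ₀ ↔ ∃ (hcpt₂ : Literature.NumberTheory.Automorphic.isCompact_glFiniteIntegralLevel 2 K₀) (S : Finset (IsDedekindDomain.HeightOneSpectrum (NumberField.RingOfIntegers K₀)))
      (π₀ β : Literature.NumberTheory.Automorphic.CuspidalAutomorphicRepData 2 K₀ hcpt₂),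
      (∀ᶠ v : IsDedekindDomain.HeightOneSpectrum (NumberField.RingOfIntegers K₀) in Filter.cofinite, SatakeFrobCompatibleAt ι π₀.1 σ₀ v) ∧
      Relation.ReflTransGen (AdmissibleSymCongruence K₀ n hcpt₂ S) π₀ β ∧ IsBaseChangeForm K₀ hcpt₂ β := Iff.rfl

/-- `ThetaReachable` unfolds to: a compatible cuspidal π₀ on GL₂ joined by an admissible chain to an Eisenstein/theta form. -/
theorem thetaReachable_iff (K₀ : Type) [Field K₀] [NumberField K₀] (n ℓ : ℕ) [Fact ℓ.Prime] (ι : PadicAlgCl ℓ ≃+* ℂ)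
    (σ₀ : Literature.NumberTheory.GaloisRepresentations.FramedGaloisRep K₀ (PadicAlgCl ℓ) 2) :
    ThetaReachable K₀ n ℓ ι σ₀ ↔ ∃ (hcpt₂ : Literature.NumberTheory.Automorphic.isCompact_glFiniteIntegralLevel 2 K₀) (S : Finset (IsDedekindDomain.HeightOneSpectrum (NumberField.RingOfIntegers K₀)))
      (π₀ β : Literature.NumberTheory.Automorphic.CuspidalAutomorphicRepData 2 K₀ hcpt₂),
      (∀ᶠ v : IsDedekindDomain.HeightOneSpectrum (NumberField.RingOfIntegers K₀) in Filter.cofinite, SatakeFrobCompatibleAt ι π₀.1 σ₀ v) ∧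
      Relation.ReflTransGen (AdmissibleSymCongruence K₀ n hcpt₂ S) π₀ β ∧ IsThetaForm K₀ n hcpt₂ β := Iff.rfl

/-! ## §2 Kernels on the route decls (rev 1) -/

/-- WEAKER (1/3): piece A is SPF restricted to dial A. -/
theorem a_of_spf (h : SymPowerFunctoriality) : Theses.SeedReachSplit.BaseChangeSeededSymPower := by
  intro K₀ _ _ n hcpt h6 hIH hCM ℓ _ ι σ₀ h1 h2 h3 h4 _
  exact h K₀ n hcpt h6 hIH hCM ℓ ι σ₀ h1 h2 h3 h4

/-- WEAKER (2/3): piece B is SPF restricted to ¬A ∧ B. -/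
theorem b_of_spf (h : SymPowerFunctoriality) : Theses.SeedReachSplit.ThetaSeededSymPower := by
  intro K₀ _ _ n hcpt h6 hIH hCM ℓ _ ι σ₀ h1 h2 h3 h4 _ _
  exact h K₀ n hcpt h6 hIH hCM ℓ ι σ₀ h1 h2 h3 h4

/-- WEAKER (3/3): the residual C is SPF restricted to ¬A ∧ ¬B. -/
theorem c_of_spf (h : SymPowerFunctoriality) : Theses.SeedReachSplit.SeedIsolatedSymPower := by
  intro K₀ _ _ n hcpt h6 hIH hCM ℓ _ ι σ₀ h1 h2 h3 h4 _ _
  exact h K₀ n hcpt h6 hIH hCM ℓ ι σ₀ h1 h2 h3 h4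

/-- EXACT CUT (←): the three pieces give SPF (excluded middle on the two dials). -/
theorem spf_of_pieces (hA : Theses.SeedReachSplit.BaseChangeSeededSymPower) (hB : Theses.SeedReachSplit.ThetaSeededSymPower) (hC : Theses.SeedReachSplit.SeedIsolatedSymPower) :
    SymPowerFunctoriality := by
  intro K₀ _ _ n hcpt h6 hIH hCM ℓ _ ι σ₀ h1 h2 h3 h4
  by_cases hbc : BCReachable K₀ n ℓ ι σ₀
  · exact hA K₀ n hcpt h6 hIH hCM ℓ ι σ₀ h1 h2 h3 h4 hbc
  by_cases hth : ThetaReachable K₀ n ℓ ι σ₀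
  · exact hB K₀ n hcpt h6 hIH hCM ℓ ι σ₀ h1 h2 h3 h4 hbc hth
  · exact hC K₀ n hcpt h6 hIH hCM ℓ ι σ₀ h1 h2 h3 h4 hbc hth

/-- EXACT CUT: SPF ⟺ A ∧ B ∧ C. -/
theorem spf_iff_pieces : SymPowerFunctoriality ↔ (Theses.SeedReachSplit.BaseChangeSeededSymPower ∧ Theses.SeedReachSplit.ThetaSeededSymPower ∧ Theses.SeedReachSplit.SeedIsolatedSymPower) :=
  ⟨fun h => ⟨a_of_spf h, b_of_spf h, c_of_spf h⟩, fun h => spf_of_pieces h.1 h.2.1 h.2.2⟩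

/-- EXACT CUT at the target: FC ⟺ A ∧ B ∧ C (modulo AVX for →). -/
theorem fc_iff_pieces (hAV : SymPowerAvatarExists) :
    CMSymmetricPowerAutomorphy ↔ (Theses.SeedReachSplit.BaseChangeSeededSymPower ∧ Theses.SeedReachSplit.ThetaSeededSymPower ∧ Theses.SeedReachSplit.SeedIsolatedSymPower) :=
  (fc_iff_spf hAV).trans spf_iff_pieces

/-- pieces ⟹ FC, OUTRIGHT (the direction the deciding theorem uses). -/
theorem fc_of_pieces (hA : Theses.SeedReachSplit.BaseChangeSeededSymPower) (hB : Theses.SeedReachSplit.ThetaSeededSymPower) (hC : Theses.SeedReachSplit.SeedIsolatedSymPower) :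
    CMSymmetricPowerAutomorphy :=
  fc_of_spf (spf_of_pieces hA hB hC)

/-- A is WEAKER than the target FC (mod AVX). -/
theorem a_of_fc (hAV : SymPowerAvatarExists) (h : CMSymmetricPowerAutomorphy) : Theses.SeedReachSplit.BaseChangeSeededSymPower := a_of_spf (spf_of_fc hAV h)
/-- B is WEAKER than FC (mod AVX). -/
theorem b_of_fc (hAV : SymPowerAvatarExists) (h : CMSymmetricPowerAutomorphy) : Theses.SeedReachSplit.ThetaSeededSymPower := b_of_spf (spf_of_fc hAV h)
/-- C is WEAKER than FC (mod AVX). -/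
theorem c_of_fc (hAV : SymPowerAvatarExists) (h : CMSymmetricPowerAutomorphy) : Theses.SeedReachSplit.SeedIsolatedSymPower := c_of_spf (spf_of_fc hAV h)

/-- FRAME certified from the HOST: the host route's other items turn SPF into Langlands (`SymmetricPowerAnchorSplit.closes` with
its FC binder fed by `fc_of_spf`). -/
theorem frame_of_host (hRES : AnchorlessSymTypeAutomorphy) (hLS : LowSymmetricPowerAutomorphy) (hFT : HilbertSymmetricPowerAutomorphy)
    (hCSD : CliffordSolvableDescent) (hT : SolvableAnchorTransport) (hF : AvatarSymmetricPowerFrame) : Theses.SeedReachSplit.SeedReachFrame :=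
  fun hSPF => Summit.Langlands.Langlands.Theses.SymmetricPowerAnchorSplit.closes hRES (fc_of_spf hSPF) hLS hFT hCSD hT hF

/-- DECIDING THEOREM of the child route (its glue is this, spelled out in pure logic): A → B → C → FRAME → Langlands. -/
theorem closes (hA : Theses.SeedReachSplit.BaseChangeSeededSymPower) (hB : Theses.SeedReachSplit.ThetaSeededSymPower) (hC : Theses.SeedReachSplit.SeedIsolatedSymPower) (hF : Theses.SeedReachSplit.SeedReachFrame) :
    _root_.Langlands :=
  hF (spf_of_pieces hA hB hC)

/-- Langlands through the host: A → B → C → (host's RES LS FT CSD T′ FRAME′) → Langlands. -/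
theorem langlands_of_pieces (hA : Theses.SeedReachSplit.BaseChangeSeededSymPower) (hB : Theses.SeedReachSplit.ThetaSeededSymPower) (hC : Theses.SeedReachSplit.SeedIsolatedSymPower)
    (hRES : AnchorlessSymTypeAutomorphy) (hLS : LowSymmetricPowerAutomorphy) (hFT : HilbertSymmetricPowerAutomorphy)
    (hCSD : CliffordSolvableDescent) (hT : SolvableAnchorTransport) (hF : AvatarSymmetricPowerFrame) : _root_.Langlands :=
  closes hA hB hC (frame_of_host hRES hLS hFT hCSD hT hF)

/-- NECESSITY certificates (Langlands ⟹ every item, modulo AVX for the pieces; SPF itself is the landed `SeedReach.spf_of_langlands`):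
Langlands ⟹ A (mod AVX). -/
theorem a_of_langlands (hAV : SymPowerAvatarExists) (hL : _root_.Langlands) : Theses.SeedReachSplit.BaseChangeSeededSymPower := a_of_spf (SeedReach.spf_of_langlands hAV hL)
/-- Langlands ⟹ B (mod AVX). -/
theorem b_of_langlands (hAV : SymPowerAvatarExists) (hL : _root_.Langlands) : Theses.SeedReachSplit.ThetaSeededSymPower := b_of_spf (SeedReach.spf_of_langlands hAV hL)
/-- Langlands ⟹ C (mod AVX). -/
theorem c_of_langlands (hAV : SymPowerAvatarExists) (hL : _root_.Langlands) : Theses.SeedReachSplit.SeedIsolatedSymPower := c_of_spf (SeedReach.spf_of_langlands hAV hL)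
/-- Langlands ⟹ FRAME″ (trivially). -/
theorem frame_of_langlands (hL : _root_.Langlands) : Theses.SeedReachSplit.SeedReachFrame := fun _ => hL

/-- Langlands ⟺ the four child items, given AVX (→) — the child route literally decides the summit. -/
theorem langlands_iff_items (hAV : SymPowerAvatarExists) :
    _root_.Langlands ↔ (Theses.SeedReachSplit.BaseChangeSeededSymPower ∧ Theses.SeedReachSplit.ThetaSeededSymPower ∧ Theses.SeedReachSplit.SeedIsolatedSymPower ∧ Theses.SeedReachSplit.SeedReachFrame) :=
  ⟨fun hL => ⟨a_of_langlands hAV hL, b_of_langlands hAV hL, c_of_langlands hAV hL, frame_of_langlands hL⟩,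
   fun h => closes h.1 h.2.1 h.2.2.1 h.2.2.2⟩

end Summit.Langlands.Langlands.Theorems.SeedReachRev1
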